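import Summits.NavierStokesRegularity.NavierStokesRegularity.Theorems.OddMorawetzLocal.Negative.OddMorawetzLocalRefutationData3
import Summits.NavierStokesRegularity.NavierStokesRegularity.Theorems.OddMorawetzLocal.Negative.OddMorawetzLocalRefutationDefsV
import HarnessLib

/-!
# Crux `OddMorawetzLocal` (stmt-NavierStokesRegularity-1376) — kernel certificates, weight 3 (part D)

The derivative orders of the weight-3 isotropic fluxes behind the `null` descriptors (`cert3_iso_fluxord`: jets of order
`≤ 3` only — the hypothesis of the null-Lagrangian lemma), and the kinds of the descriptors `1 … 16` (`cert3_iso_kinds'`,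
restated with the live descriptor pinned). No analysis; lands `--supports` the crux item.
-/

set_option linter.dupNamespace false

namespace Summit.NavierStokesRegularity.NavierStokesRegularity.Theorems.OddMorawetz

/-- The isotropic fluxes behind the weight-3 `null` descriptors only involve jets of order `≤ 3`. -/
theorem cert3_iso_fluxord : (isoDesc3.all fun d => match d with
      | .null sh mt => [isoFlux sh mt 0, isoFlux sh mt 1, isoFlux sh mt 2].all fun F =>
          F.all fun t => t.2.all fun u => decide (u.2.length ≤ 3)
      | _ => true) = true := by
  decide +kernel

end Summit.NavierStokesRegularity.NavierStokesRegularity.Theorems.OddMorawetz
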